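import Literature.AlgebraicGeometry.Frobenioids.DivisorMonoidCategoryTheoreticityCorProofsVII
import Literature.AlgebraicGeometry.Frobenioids.BirationalTower
import Literature.AlgebraicGeometry.Frobenioids.DivisorMonoidCategoryTheoreticityFacts
import HarnessLib

/-!
# Frobenioids I, Corollary 4.11 (i)(ii)(iii) — SUB-DAG statements (cell sub-DAG S2, L1-lead R53 (A)), v2

Mochizuki, *The geometry of Frobenioids I: the general theory*, Kyushu J. Math. **62** (2008)
293–400, kurims text Cor. 4.11 pp. 91–94 [cite: MochizukiFrdI2008, Cor. 4.11 p.91].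

STATEMENTS + COMPOSITIONS for the discharge of [FrdI] Cor. 4.11 (i)(ii)(iii) (typed as
`PreFrobenioidData.Cor411i/ii/iii`, seat abc-iut-L1-t3; named fact `FrdI.Cor411ii`, file
`DivisorMonoidCategoryTheoreticityFacts`). The printed proof is cut into the sub-nodes L01–L20 listed on the
cell INBOX (abc-iut-L1-d6); those already PROVED live in `DivisorMonoidCategoryTheoreticityCorProofs*`,
`DivisorMonoidIsoDescent`, `BaseSquareUniqueness`, `BaseSquareComposition`, `BirationalTower`,
`UnitTrivialisationFunctoriality`, `UnitTrivialisationRigidity`, `BaseDivRigidity` (abc-iut-L1-d6),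
`EquivalenceUnitsDivSlim` (abc-iut-L1-t10), `BirationalizationCategoryTheoreticity`/`…Cor410` (Cor. 4.10,
`Ψ^birat := PreFrobenioid.mapOfEquiv`) and `BirationalizationBaseIsoTransport` (abc-iut-L6-t20). v2 (review of
v1: an abstract "tower exists" fact is a restatement of the target — dropped) records ONLY the concrete open
piece as a named fact and states/proves the compositions:

* `FrdI.BiratEquivPreservesUnits` — sub-node L11 (p. 93 ll. 36–46): at THE birationalizations
  (`PreFrobenioid.Birat`, operations `biratOps` over `0_D`), every equivalence `C₁^birat ⥲ C₂^birat` lying over `Ψ`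
  (such as `Ψ^birat = mapOfEquiv`, Cor. 4.10) and its quasi-inverse preserve `O^×(−)`, for Frobenioids with
  the hypotheses of Cor. 4.11 of isotropic, non-group-like type (print's reduced case, p. 92 ll. 1–8);
* `FrdI.cor411ii_of_pieces` — COMPOSITION (ii) in print's reduced case, PROVED: `FrdI.BiratEquivPreservesUnits`
  together with the DATA of sub-node L13 (THE operations `SU_i` of `(C_i^birat)^un-tr` with their base
  factorisation — construction row abc-iut-L1-d5 — and a Prop. 3.11 (iii)-shaped base square for the induced
  `(Ψ^birat)^un-tr`, seat abc-iut-L1-t13) and Cor. 4.10's `Ψ^birat` give the typed Cor. 4.11 (ii)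
  (`BirationalTower.cor411ii_of_birat_pieces`);
* `FrdI.Cor411iRestrict` / `FrdI.cor411iRestrict_of_facts` — (i) for THE restriction `Ψ^istr` in print's
  reduced case, PROVED from `FrdI.Thm34i`, `FrdI.Thm34iii`, `FrdI.Thm42i` (units: L01 abc-iut-L1-t10;
  functoriality of `C^un-tr`, `1`-uniqueness, rigidity: L04–L06);
* (iii): COMPOSITION = `PreFrobenioid.cor411iii_of_fact_of_thm49` (`…CorProofsII`), nothing further to state.
The group-like case of (ii) is `cor411ii_groupLike_of_fact` (⇐ `FrdI.Thm34v`), the reduction of general `C_i`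
to isotropic type (p. 92 l. 1, Thm. 3.4 (i) + Rem. 4.5.1) is sub-node L00, not stated here.

No statement of the paper is strengthened; nothing here is specific to the abc programme.
-/

namespace Literature.AlgebraicGeometry.Frobenioids

open CategoryTheory Opposite

universe w v v' u u'

namespace FrdI

/-- **[FrdI] Cor. 4.11 (ii), sub-node L11** (p. 93 ll. 36–46: "since `D_i` is Div-slim, the base-identity
endomorphisms of `A ∈ Ob(C_i^birat)` may be characterized as … we thus conclude that `Ψ^birat` preserves the
base-identity endomorphisms [hence, in particular, that `Ψ^birat` preserves '`O^×(−)`']") as a named fact, in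
print's reduced case (isotropic, non-group-like type, p. 92 ll. 1–8): at THE birationalizations, every
equivalence `E : C₁^birat ⥲ C₂^birat` lying over `Ψ` — e.g. `Ψ^birat = PreFrobenioid.mapOfEquiv` (Cor. 4.10) —
and its quasi-inverse map units to units. [cite: MochizukiFrdI2008, Cor. 4.11 (ii) p.93] -/
def BiratEquivPreservesUnits : Prop :=
  ∀ {D₁ : Type u} [Category.{v} D₁] {Φ₁ : D₁ᵒᵖ ⥤ CommMonCat.{w}} {C₁ : Type u'} [Category.{v'} C₁]
    {D₂ : Type u} [Category.{v} D₂] {Φ₂ : D₂ᵒᵖ ⥤ CommMonCat.{w}} {C₂ : Type u'} [Category.{v'} C₂]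
    (F₁ : C₁ ⥤ ElemFrobenioid Φ₁) (F₂ : C₂ ⥤ ElemFrobenioid Φ₂)
    (hF₁ : PreFrobenioid.IsFrobenioid F₁) (hsq₁ : PreFrobenioid.HasBiratSquares F₁)
    (hF₂ : PreFrobenioid.IsFrobenioid F₂) (hsq₂ : PreFrobenioid.HasBiratSquares F₂),
      (∀ X : D₁, IsPerfFactorial (Φ₁.obj (Opposite.op X))) →
      (∀ X : D₂, IsPerfFactorial (Φ₂.obj (Opposite.op X))) →
        ∀ Ψ : C₁ ≌ C₂,
          (PreFrobenioidData.ofFunctor Φ₁ F₁).Cor411Setting (PreFrobenioidData.ofFunctor Φ₂ F₂) Ψ →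
          (PreFrobenioidData.ofFunctor Φ₁ F₁).Thm42Setting (PreFrobenioidData.ofFunctor Φ₂ F₂) →
            ∀ (E : PreFrobenioid.Birat F₁ hF₁ hsq₁ ≌ PreFrobenioid.Birat F₂ hF₂ hsq₂),
              Nonempty (PreFrobenioid.toBirat F₁ hF₁ hsq₁ ⋙ E.functor ≅ Ψ.functor ⋙ PreFrobenioid.toBirat F₂ hF₂ hsq₂) →
                (∀ (X : PreFrobenioid.Birat F₁ hF₁ hsq₁) (u : Aut X),
                    u ∈ (PreFrobenioid.biratOps hF₁ hsq₁).unitsSubgroup X →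
                      E.functor.mapIso u ∈ (PreFrobenioid.biratOps hF₂ hsq₂).unitsSubgroup (E.functor.obj X)) ∧
                (∀ (Y : PreFrobenioid.Birat F₂ hF₂ hsq₂) (u : Aut Y),
                    u ∈ (PreFrobenioid.biratOps hF₂ hsq₂).unitsSubgroup Y →
                      E.inverse.mapIso u ∈ (PreFrobenioid.biratOps hF₁ hsq₁).unitsSubgroup (E.inverse.obj Y))

/-- **COMPOSITION of [FrdI] Cor. 4.11 (ii)** in print's reduced case (FrdI p. 93 l. 30 – p. 94 l. 8): the named
fact L11 (`FrdI.BiratEquivPreservesUnits`), Cor. 4.10's `Ψ^birat` (any equivalence of THE birationalizations over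
`Ψ`, `C_i^birat` isotropic) and the DATA of sub-node L13 — operations `SU_i` on `(C_i^birat)^un-tr` whose base
factors that of `C_i^birat`, with a Prop. 3.11 (iii)-shaped `1`-unique base square for the induced
`(Ψ^birat)^un-tr` — give the typed Cor. 4.11 (ii) (lift to `(C^birat)^istr`, `(Ψ^birat)^un-tr`, "composing
diagrams", `1`-uniqueness and rigidity kernel-checked in `BirationalTower` and its imports).
[cite: MochizukiFrdI2008, Cor. 4.11 (ii) p.93] -/
theorem cor411ii_of_pieces (hL11 : BiratEquivPreservesUnits.{w, v, v', u, u'})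
    {D₁ : Type u} [Category.{v} D₁] {Φ₁ : D₁ᵒᵖ ⥤ CommMonCat.{w}} {C₁ : Type u'} [Category.{v'} C₁]
    {D₂ : Type u} [Category.{v} D₂] {Φ₂ : D₂ᵒᵖ ⥤ CommMonCat.{w}} {C₂ : Type u'} [Category.{v'} C₂]
    {F₁ : C₁ ⥤ ElemFrobenioid Φ₁} {F₂ : C₂ ⥤ ElemFrobenioid Φ₂}
    (hF₁ : PreFrobenioid.IsFrobenioid F₁) (hsq₁ : PreFrobenioid.HasBiratSquares F₁)
    (hF₂ : PreFrobenioid.IsFrobenioid F₂) (hsq₂ : PreFrobenioid.HasBiratSquares F₂)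
    (hpf₁ : ∀ X : D₁, IsPerfFactorial (Φ₁.obj (Opposite.op X)))
    (hpf₂ : ∀ X : D₂, IsPerfFactorial (Φ₂.obj (Opposite.op X))) (Ψ : C₁ ≌ C₂)
    (hs : (PreFrobenioidData.ofFunctor Φ₁ F₁).Cor411Setting (PreFrobenioidData.ofFunctor Φ₂ F₂) Ψ)
    (h42 : (PreFrobenioidData.ofFunctor Φ₁ F₁).Thm42Setting (PreFrobenioidData.ofFunctor Φ₂ F₂))
    (hiso₁ : (PreFrobenioid.biratOps hF₁ hsq₁).IsOfIsotropicType)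
    (hiso₂ : (PreFrobenioid.biratOps hF₂ hsq₂).IsOfIsotropicType)
    (E : PreFrobenioid.Birat F₁ hF₁ hsq₁ ≌ PreFrobenioid.Birat F₂ hF₂ hsq₂)
    (sq : PreFrobenioid.toBirat F₁ hF₁ hsq₁ ⋙ E.functor ≅ Ψ.functor ⋙ PreFrobenioid.toBirat F₂ hF₂ hsq₂)
    (SU₁ : PreFrobenioidData.{w} (PreFrobenioid.biratOps hF₁ hsq₁).Untr D₁)
    (SU₂ : PreFrobenioidData.{w} (PreFrobenioid.biratOps hF₂ hsq₂).Untr D₂)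
    (ιU₁ : (PreFrobenioid.biratOps hF₁ hsq₁).toUntr ⋙ SU₁.base ≅
      (PreFrobenioid.biratOps hF₁ hsq₁).istrι ⋙ (PreFrobenioid.biratOps hF₁ hsq₁).base)
    (ιU₂ : (PreFrobenioid.biratOps hF₂ hsq₂).toUntr ⋙ SU₂.base ≅
      (PreFrobenioid.biratOps hF₂ hsq₂).istrι ⋙ (PreFrobenioid.biratOps hF₂ hsq₂).base)
    (hU : ∀ (G : (PreFrobenioid.biratOps hF₁ hsq₁).Istr ≌ (PreFrobenioid.biratOps hF₂ hsq₂).Istr)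
      (ΨU : (PreFrobenioid.biratOps hF₁ hsq₁).Untr ⥤ (PreFrobenioid.biratOps hF₂ hsq₂).Untr),
      ΨU.IsEquivalence →
        OneCommutes G.functor (PreFrobenioid.biratOps hF₂ hsq₂).toUntr (PreFrobenioid.biratOps hF₁ hsq₁).toUntr ΨU →
          ∃ ΨBase : D₁ ⥤ D₂, ΨBase.IsEquivalence ∧ OneCommutes ΨU SU₂.base SU₁.base ΨBase) :
    (PreFrobenioidData.ofFunctor Φ₁ F₁).Cor411ii (PreFrobenioidData.ofFunctor Φ₂ F₂) Ψ := by
  obtain ⟨hu, hu'⟩ := hL11 F₁ F₂ hF₁ hsq₁ hF₂ hsq₂ hpf₁ hpf₂ Ψ hs h42 E ⟨sq⟩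
  exact PreFrobenioid.cor411ii_of_birat_pieces hF₁ hsq₁ hF₂ hsq₂ Ψ hiso₁ hiso₂ E sq hu hu' SU₁ SU₂ ιU₁ ιU₂ hU

/-- **[FrdI] Cor. 4.11 (i) for the restriction `Ψ^istr`**, in print's reduced case ("we may assume without loss of
generality that `C₁, C₂` are of isotropic type … [and] not of group-like type", p. 92 ll. 1–8), as a named
statement: under the hypotheses of Cor. 4.11, for Frobenioids of isotropic and not of group-like type, there is
`Ψ^istr : C₁^istr ⥲ C₂^istr` over `Ψ` for which the typed Cor. 4.11 (i) holds (a `1`-unique `Ψ^un-tr` and the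
rigidity of the composites). [cite: MochizukiFrdI2008, Cor. 4.11 (i) p.91] -/
def Cor411iRestrict : Prop :=
  ∀ {D₁ : Type u} [Category.{v} D₁] {Φ₁ : D₁ᵒᵖ ⥤ CommMonCat.{w}} {C₁ : Type u'} [Category.{v'} C₁]
    {D₂ : Type u} [Category.{v} D₂] {Φ₂ : D₂ᵒᵖ ⥤ CommMonCat.{w}} {C₂ : Type u'} [Category.{v'} C₂]
    (F₁ : C₁ ⥤ ElemFrobenioid Φ₁) (F₂ : C₂ ⥤ ElemFrobenioid Φ₂),
      PreFrobenioid.IsFrobenioid F₁ → PreFrobenioid.IsFrobenioid F₂ →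
      (∀ X : D₁, IsPerfFactorial (Φ₁.obj (Opposite.op X))) →
      (∀ X : D₂, IsPerfFactorial (Φ₂.obj (Opposite.op X))) →
        ∀ Ψ : C₁ ≌ C₂,
          (PreFrobenioidData.ofFunctor Φ₁ F₁).Cor411Setting (PreFrobenioidData.ofFunctor Φ₂ F₂) Ψ →
          (PreFrobenioidData.ofFunctor Φ₁ F₁).Thm42Setting (PreFrobenioidData.ofFunctor Φ₂ F₂) →
            ∃ Ψistr : (PreFrobenioidData.ofFunctor Φ₁ F₁).Istr ≌ (PreFrobenioidData.ofFunctor Φ₂ F₂).Istr,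
              Ψistr.functor ⋙ (PreFrobenioidData.ofFunctor Φ₂ F₂).istrι =
                  (PreFrobenioidData.ofFunctor Φ₁ F₁).istrι ⋙ Ψ.functor ∧
                (PreFrobenioidData.ofFunctor Φ₁ F₁).Cor411i (PreFrobenioidData.ofFunctor Φ₂ F₂) Ψ Ψistr.functor

/-- **COMPOSITION of [FrdI] Cor. 4.11 (i)** in print's reduced case (FrdI pp. 92–93): `FrdI.Cor411iRestrict`
follows from [FrdI] Thm. 3.4 (i) (isotropic objects are preserved), Thm. 3.4 (iii) (pull-back morphisms) and
Thm. 4.2 (i) (Div-identity endomorphisms) — the preservation of `O^×(−)` (seat abc-iut-L1-t10), the functoriality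
of `C^un-tr`, the `1`-uniqueness and the rigidity (Div-slimness) being kernel-checked.
[cite: MochizukiFrdI2008, Cor. 4.11 (i) p.92] -/
theorem cor411iRestrict_of_facts (h34i : Thm34i.{w, v, v', u, u'}) (h34iii : Thm34iii.{w, v, v', u, u'})
    (h42i : Thm42i.{w, v, v', u, u'}) : Cor411iRestrict.{w, v, v', u, u'} := by
  intro D₁ _ Φ₁ C₁ _ D₂ _ Φ₂ C₂ _ F₁ F₂ hF₁ hF₂ hpf₁ hpf₂ Ψ hs h42s
  have hq₁ := hs.standard.1.quasiIsotropic
  have hq₂ := hs.standard.2.quasiIsotropic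
  -- Thm. 3.4 (i): `Ψ`, `Ψ⁻¹` preserve isotropic objects
  have hiso : ∀ A : C₁, (PreFrobenioidData.ofFunctor Φ₂ F₂).IsIsotropic (Ψ.functor.obj A) ↔
      (PreFrobenioidData.ofFunctor Φ₁ F₁).IsIsotropic A := fun A => by
    constructor
    · intro h
      have h' := (h34i F₂ F₁ hF₂ hF₁ Ψ.symm hq₂ hq₁).1 h
      rw [PreFrobenioidData.ofFunctor_isIsotropic] at h' ⊢
      exact PreFrobenioid.IsIsotropic.of_iso hF₁.isPreFrobenioid (Ψ.unitIso.app A) h'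
    · intro h
      exact (h34i F₁ F₂ hF₁ hF₂ Ψ hq₁ hq₂).1 h
  -- `HypB` for `Ψ⁻¹`
  have hB' : (PreFrobenioidData.ofFunctor Φ₂ F₂).HypB (PreFrobenioidData.ofFunctor Φ₁ F₁) Ψ.symm :=
    fun g₂ g₁ => ⟨(hs.hypB g₁ g₂).2, (hs.hypB g₁ g₂).1⟩
  -- Thm. 3.4 (iii): pull-back morphisms; Thm. 4.2 (i): Div-identity endomorphisms
  obtain ⟨⟨-, -, -, -, hpb, -, -⟩, -⟩ := h34iii F₁ F₂ hF₁ hF₂ Ψ hs.standard.1 hs.standard.2 hs.hypB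
  obtain ⟨⟨-, -, -, -, hpb', -, -⟩, -⟩ := h34iii F₂ F₁ hF₂ hF₁ Ψ.symm hs.standard.2 hs.standard.1 hB'
  have h42s' : (PreFrobenioidData.ofFunctor Φ₂ F₂).Thm42Setting (PreFrobenioidData.ofFunctor Φ₁ F₁) :=
    { standard := ⟨h42s.standard.2, h42s.standard.1⟩
      isotropic := ⟨h42s.isotropic.2, h42s.isotropic.1⟩
      notGroupLike := ⟨h42s.notGroupLike.2, h42s.notGroupLike.1⟩ }
  obtain ⟨-, hdi, -⟩ := h42i F₁ F₂ hF₁ hF₂ hpf₁ hpf₂ Ψ h42s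
  obtain ⟨-, hdi', -⟩ := h42i F₂ F₁ hF₂ hF₁ hpf₂ hpf₁ Ψ.symm h42s'
  exact PreFrobenioid.cor411i_restrict F₁ F₂ Ψ hF₁ hF₂ hiso hs.divSlim.1 hs.divSlim.2 hpb hpb' hdi hdi'

end FrdI

end Literature.AlgebraicGeometry.Frobenioids
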